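import Literature.MathematicalPhysics.QuantumLattice.HubbardLangerMattisBound
import Literature.MathematicalPhysics.QuantumLattice.HubbardSzSectorLadder
import HarnessLib

/-!
# The Langer–Mattis species split on Lieb's sectors: Fermi-sum lower bounds

Topic `MathematicalPhysics/QuantumLattice`, family `hubbard`. A sector refinement of
`HubbardLangerMattisBound.lean` (Langer–Mattis' splitting `H = H_↑ + H_↓`, `E₀ ≥ E₁ + E₂`
[LangerMattis1971, eqs. (4)–(5)], each species moving in the frozen configurations of the other).
There the one-body energies `dΓ_σ(A_w)` were bounded on ALL of Fock space by the sum of the negative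
eigenvalues of `A_w` (grand-canonical at chemical potential `U/4`, closed by the Kennedy–Lieb
chessboard estimate). Here the particle numbers are kept: on Lieb's sector `(a, b)` (`a` up-, `b`
down-electrons) the rotated `σ`-occupations of any vector sum to `n_σ ‖ψ‖²`, so the bathtub principle
gives `Re ⟨ψ, dΓ_σ(A_w) ψ⟩ ≥ (sum of the n_σ lowest eigenvalues of A_w) ‖ψ‖²` — everything PROVED:

* `fermiSum_mul_normSq_le_re_rayleigh_dGammaSpin` — the one-species bathtub bound on Fock space for a
  Hermitian site matrix `A` and a vector all of whose configurations carry `n` electrons of spin `σ`: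
  `c ‖φ‖² ≤ Re ⟨φ, dΓ_σ(A) φ⟩` whenever `c ≤ Σ_{i ∈ I} λ_i(A)` for every `n`-set `I` of levels;
* `fermiSum_mul_normSq_le_re_rayleigh_speciesHamiltonian` — the species Hamiltonian `H_σ` on vectors
  with `n_σ` mobile and `n_τ` frozen electrons: `c ‖ψ‖² ≤ Re ⟨ψ, H_σ ψ⟩` whenever
  `c ≤ Σ_{i ∈ I} λ_i(A_w)` for every frozen configuration `|w| = n_τ` and every `n_σ`-set `I`
  (`A_w = -tA_G + (U/2) 1_w`, `lmOneBody`);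
* `fermiSum_mul_normSq_le_re_rayleigh_hamiltonian_of_isInSector` — Langer–Mattis' `E₀ ≥ E₁ + E₂` on
  the sector `(a, b)`: `(c₀ + c₁) ‖ψ‖² ≤ Re ⟨ψ, H ψ⟩`;
* `groundEnergyAt_ge_of_forall_isInSector` — a bound valid on every sector `(a, N - a)` bounds
  `groundEnergyAt G t U N` (`H` conserves `(N_↑, N_↓)`; a ground state has a nonzero sector component);
* `groundEnergyAt_ge_of_fermiSums` — **the assembled certificate form**:
  `E_G(N) ≥ c` as soon as for every splitting `a + b = N` (`a, b ≤ |Λ|`) there are `c₀ + c₁ ≥ c` with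
  `c₀ ≤` every `a`-level sum of every `A_w`, `|w| = b`, and `c₁ ≤` every `b`-level sum of every
  `A_w`, `|w| = a` — i.e. `E_G(N) ≥ min_{a+b=N} [F(a;b) + F(b;a)]` with
  `F(a;b) = min_{|w|=b} (sum of the a lowest eigenvalues of A_w)`, valid for ALL real `t, U` and every
  finite graph (no bipartiteness needed at this stage);
* `card_mul_add_sum_min_sub_le_sum` — the Lagrange form `|I| μ + Σ_i min(λ_i - μ, 0) ≤ Σ_{i∈I} λ_i`
  by which such level sums are bounded from spectral data (at `μ = U/4`, `|I| + |w| = |Λ|` this is the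
  route of `HubbardLangerMattisBound.lean`).

## References

* W. D. Langer, D. C. Mattis, Phys. Lett. 36A (1971) 139–140, eqs. (4)–(5). [LangerMattis1971]
* E. H. Lieb, M. Loss, *Analysis*, 2nd ed. (AMS 2001), Theorem 1.14 (bathtub principle). [folklore]
* E. H. Lieb, Phys. Rev. Lett. 62 (1989) 1201, proof of Theorem 1 (the sectors `(a, b)`). [LiebPRL1989]

## Mathlib / tree search

Tree (REUSED): `LangerMattis.configProj`, `occ`, `rayleigh_eq_sum_configProj`,
`sum_normSq_configProj_mulVec`, `commute_speciesHamiltonian_configProj`,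
`speciesHamiltonian_mul_configProj`, `hamiltonian_eq_add_speciesHamiltonian`, `lmOneBody_eq_fkOneBody`,
`re_rayleigh_dGammaSpin_eq_sum` (part 1); `exists_fermiSet`, `sum_fermiSet_le` (abstract bathtub,
`FreeFermionSectorEnergyDeviation.lean`); `sum_numberMode_spinMode`, `spinMode_unit`,
`normSq_annihilate_mulVec_le`, `star_dotProduct_numberMode_mulVec`, `sum_numberOp_mulVec_apply`;
`IsInSector`, `sectorProj`, `sum_sectorProj_eq`, `PreservesSectors.mulVec_sectorProj`, `le_card_of_isInSector`,
`LiebThm1.preservesSectors_hamiltonian`, `ThermodynamicLimit.exists_unit_groundState`. Mathlib: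
`Matrix.IsHermitian.eigenvectorUnitary`, `mulVec_eigenvectorBasis`.
-/

namespace Literature.MathematicalPhysics.QuantumLattice

namespace LangerMattis

open Matrix Finset Literature.MathematicalPhysics.QuantumLattice.RayleighBound
  Literature.MathematicalPhysics.QuantumLattice.HubbardBandBottom
open scoped ComplexOrder ComplexConjugate

variable {Λ : Type*} [LinearOrder Λ] [Fintype Λ]

/-! ### Species occupation counts -/

/-- If every configuration in the support of `ψ` carries exactly `n` electrons of spin `σ` then
`Re ⟨ψ, N_σ ψ⟩ = n ‖ψ‖²`. [folklore] -/
theorem re_rayleigh_speciesNumber_eq (σ : Fin 2) {n : ℕ} {ψ : Fock (Orb Λ)}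
    (hocc : ∀ s, ψ s ≠ 0 → (occ σ s).card = n) :
    (star ψ ⬝ᵥ ((∑ x : Λ, numberOp x σ) *ᵥ ψ)).re = n * normSq ψ := by
  have h : star ψ ⬝ᵥ ((∑ x : Λ, numberOp x σ) *ᵥ ψ) = (n : ℂ) * (star ψ ⬝ᵥ ψ) := by
    rw [dotProduct, dotProduct, Finset.mul_sum]
    refine Finset.sum_congr rfl fun s _ => ?_
    rw [sum_numberOp_mulVec_apply, Pi.star_apply]
    by_cases hs : ψ s = 0
    · simp [hs]
    · have hocc' : (univ.filter fun x : Λ => orb x σ ∈ s) = occ σ s := rfl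
      rw [hocc', hocc s hs]
      ring
  rw [h, star_dotProduct_self_eq_normSq, ← Complex.ofReal_natCast, ← Complex.ofReal_mul,
    Complex.ofReal_re]

/-- On Lieb's sector `(a, b)` every configuration of the support has `a` up- and `b`
down-electrons (`occ 0 = upPart`, `occ 1 = downPart`). [cite: LiebPRL1989, proof of Theorem 1] -/
theorem card_occ_of_isInSector {a b : ℕ} {ψ : Fock (Orb Λ)} (hψ : IsInSector a b ψ)
    {s : Finset (Orb Λ)} (hs : ψ s ≠ 0) : (occ 0 s).card = a ∧ (occ 1 s).card = b := by
  by_contra h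
  exact hs (hψ s h)

/-- `‖φ‖² = 0` only for `φ = 0`. [folklore] -/
theorem eq_zero_of_normSq_eq_zero {ι : Type*} [Fintype ι] {φ : Fock ι} (h : normSq φ = 0) :
    φ = 0 := by
  funext s
  have hs := (Finset.sum_eq_zero_iff_of_nonneg fun s _ => by positivity).1 h s (Finset.mem_univ s)
  rwa [sq_eq_zero_iff, norm_eq_zero] at hs

/-! ### One species: the bathtub bound on Fock space -/

section OneBody

/-- **The bathtub bound for `dΓ_σ(A)`.** Let `A` be a Hermitian site matrix with eigenvalues `λ_i`
and let every configuration in the support of `φ` carry exactly `n ≤ |Λ|` electrons of spin `σ`.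
If `c ≤ Σ_{i ∈ I} λ_i` for every `n`-set of levels `I`, then `c ‖φ‖² ≤ Re ⟨φ, dΓ_σ(A) φ⟩`: along
the eigenmodes the rotated `σ`-occupations lie in `[0, ‖φ‖²]` and sum to `n ‖φ‖²` (Parseval), and the
bathtub principle (Lieb–Loss, *Analysis*, Thm 1.14) puts the minimum at a Fermi set. [folklore] -/
theorem fermiSum_mul_normSq_le_re_rayleigh_dGammaSpin (σ : Fin 2) {A : Matrix Λ Λ ℂ}
    (hA : A.IsHermitian) {n : ℕ} (hn : n ≤ Fintype.card Λ) {φ : Fock (Orb Λ)}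
    (hocc : ∀ s, φ s ≠ 0 → (occ σ s).card = n)
    {c : ℝ} (hc : ∀ I : Finset Λ, I.card = n → c ≤ ∑ i ∈ I, hA.eigenvalues i) :
    c * normSq φ ≤ (star φ ⬝ᵥ (dGammaSpin σ A *ᵥ φ)).re := by
  classical
  set V : Matrix Λ Λ ℂ := (hA.eigenvectorUnitary : Matrix Λ Λ ℂ) with hVdef
  have hVV : V * star V = 1 := Matrix.mem_unitaryGroup_iff.1 hA.eigenvectorUnitary.2
  have hVV' : star V * V = 1 := Matrix.mem_unitaryGroup_iff'.1 hA.eigenvectorUnitary.2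
  set v : Λ → Λ → ℂ := fun k x => V x k with hvdef
  have hv : ∀ x y : Λ, ∑ k, v k x * star (v k y) = if x = y then 1 else 0 := fun x y => by
    have h := congrFun (congrFun hVV x) y
    simp only [Matrix.mul_apply, Matrix.star_apply, Matrix.one_apply] at h
    exact h
  have hon : ∀ k l, star (v k) ⬝ᵥ v l = if k = l then 1 else 0 := fun k l => by
    have h := congrFun (congrFun hVV' k) l
    simp only [Matrix.mul_apply, Matrix.star_apply, Matrix.one_apply] at h
    rw [dotProduct]
    simpa only [Pi.star_apply] using h
  have heig : ∀ k, A *ᵥ v k = ((hA.eigenvalues k : ℝ) : ℂ) • v k := fun k => by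
    have hcol : v k = ⇑(hA.eigenvectorBasis k) := by
      funext x
      show V x k = _
      rw [hVdef, Matrix.IsHermitian.eigenvectorUnitary_apply]
    rw [hcol, hA.mulVec_eigenvectorBasis k]
    funext x
    simp only [Pi.smul_apply, Complex.real_smul, smul_eq_mul]
  set w : Λ × Fin 2 → Orb Λ → ℂ := fun p o => if (ofLex o).2 = p.2 then v p.1 (ofLex o).1 else 0
    with hwdef
  have hw : ∀ p o, w p o = if (ofLex o).2 = p.2 then v p.1 (ofLex o).1 else 0 := fun p o => rfl
  rw [re_rayleigh_dGammaSpin_eq_sum σ A v hA.eigenvalues hv heig w hw φ]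
  have h0 : ∀ k, 0 ≤ normSq (annihilate (w (k, σ)) *ᵥ φ) := fun k => normSq_nonneg _
  have h1 : ∀ k, normSq (annihilate (w (k, σ)) *ᵥ φ) ≤ normSq φ := fun k =>
    normSq_annihilate_mulVec_le (spinMode_unit v hon w hw (k, σ)) φ
  -- Parseval: the rotated `σ`-occupations sum to `n ‖φ‖²`
  have hsum : ∑ k, normSq (annihilate (w (k, σ)) *ᵥ φ) = n * normSq φ := by
    have h := re_rayleigh_speciesNumber_eq σ hocc
    rw [← sum_numberMode_spinMode v hv w hw σ, Matrix.sum_mulVec, dotProduct_sum, Complex.re_sum] at h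
    rw [← h]
    refine Finset.sum_congr rfl fun k _ => ?_
    rw [star_dotProduct_numberMode_mulVec, Complex.ofReal_re]
  obtain ⟨F, eF, hF, hFle, hFge⟩ := exists_fermiSet hA.eigenvalues hn
  by_cases hφ0 : normSq φ = 0
  · have hz : ∀ k, normSq (annihilate (w (k, σ)) *ᵥ φ) = 0 := fun k =>
      le_antisymm (hφ0 ▸ h1 k) (h0 k)
    simp only [hz, hφ0, mul_zero, Finset.sum_const_zero, le_refl]
  have hpos : 0 < normSq φ := lt_of_le_of_ne (normSq_nonneg φ) (Ne.symm hφ0)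
  have hbath := sum_fermiSet_le hA.eigenvalues (fun k => normSq (annihilate (w (k, σ)) *ᵥ φ) / normSq φ)
    F eF hFle hFge (fun k => div_nonneg (h0 k) hpos.le) (fun k => (div_le_one hpos).2 (h1 k))
    (by rw [← Finset.sum_div, hsum, hF, mul_div_assoc, div_self hφ0, mul_one])
  calc c * normSq φ ≤ (∑ k ∈ F, hA.eigenvalues k) * normSq φ :=
        mul_le_mul_of_nonneg_right (hc F hF) hpos.le
    _ ≤ (∑ k, hA.eigenvalues k * (normSq (annihilate (w (k, σ)) *ᵥ φ) / normSq φ)) * normSq φ :=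
        mul_le_mul_of_nonneg_right hbath hpos.le
    _ = ∑ k, hA.eigenvalues k * normSq (annihilate (w (k, σ)) *ᵥ φ) := by
        rw [Finset.sum_mul]
        refine Finset.sum_congr rfl fun k _ => ?_
        rw [mul_assoc, div_mul_cancel₀ _ hφ0]

/-- **Lagrange form of a level sum**: for every `μ`, `|I| μ + Σ_i min(λ_i - μ, 0) ≤ Σ_{i ∈ I} λ_i`
(with equality when `I` is a Fermi set and `μ` its Fermi level) — the spectral quantity by which the
hypotheses of the bathtub bounds are verified. [folklore] -/
theorem card_mul_add_sum_min_sub_le_sum (e : Λ → ℝ) (μ : ℝ) (I : Finset Λ) :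
    I.card * μ + ∑ i, min (e i - μ) 0 ≤ ∑ i ∈ I, e i := by
  classical
  have h1 : ∑ i, min (e i - μ) 0 ≤ ∑ i ∈ I, min (e i - μ) 0 := by
    rw [← Finset.sum_add_sum_compl I (fun i => min (e i - μ) 0)]
    have : ∑ i ∈ Iᶜ, min (e i - μ) 0 ≤ 0 := Finset.sum_nonpos fun i _ => min_le_right _ _
    linarith
  have h2 : ∑ i ∈ I, min (e i - μ) 0 ≤ ∑ i ∈ I, (e i - μ) :=
    Finset.sum_le_sum fun i _ => min_le_left _ _
  rw [Finset.sum_sub_distrib, Finset.sum_const, nsmul_eq_mul] at h2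
  linarith

end OneBody

/-! ### The species Hamiltonians on vectors with fixed species numbers -/

variable (G : SimpleGraph Λ) [DecidableRel G.Adj]

omit [Fintype Λ] in
/-- `A_w` is Hermitian. [folklore] -/
theorem isHermitian_lmOneBody (t U : ℝ) (w : Finset Λ) : (lmOneBody G t U w).IsHermitian := by
  rw [lmOneBody_eq_fkOneBody]
  refine (FalicovKimball.isHermitian_fkOneBody (hopMatrix G t) (U / 4) (pmSign w)
    (isHermitian_hopMatrix G t)).add ?_
  rw [Matrix.IsHermitian, Matrix.conjTranspose_smul, Matrix.conjTranspose_one, Complex.star_def,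
    Complex.conj_ofReal]

/-- Coordinates of `P^τ_w ψ`. [folklore] -/
theorem configProj_mulVec_apply (τ : Fin 2) (w : Finset Λ) (ψ : Fock (Orb Λ))
    (s : Finset (Orb Λ)) : (configProj τ w *ᵥ ψ) s = if occ τ s = w then ψ s else 0 := by
  rw [configProj, mulVec_diagonal]
  split_ifs
  · rw [one_mul]
  · rw [zero_mul]

/-- **The species bound with fixed numbers** (Langer–Mattis' `E_σ` [LangerMattis1971, eq. (5)],
minimised over the frozen configurations): let every configuration in the support of `ψ` carry
`n_σ ≤ |Λ|` electrons of the mobile species `σ` and `n_τ` of the frozen species `τ ≠ σ`. If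
`c ≤ Σ_{i ∈ I} λ_i(A_w)` for every frozen configuration `|w| = n_τ` and every `n_σ`-set of levels `I`
(`A_w = -tA_G + (U/2) 1_w`), then `c ‖ψ‖² ≤ Re ⟨ψ, H_σ ψ⟩`.
[cite: LangerMattis1971, eqs. (4)–(5)] -/
theorem fermiSum_mul_normSq_le_re_rayleigh_speciesHamiltonian (t U : ℝ) {σ τ : Fin 2} (hστ : σ ≠ τ)
    {nσ nτ : ℕ} (hnσ : nσ ≤ Fintype.card Λ) {ψ : Fock (Orb Λ)}
    (hσ : ∀ s, ψ s ≠ 0 → (occ σ s).card = nσ) (hτ : ∀ s, ψ s ≠ 0 → (occ τ s).card = nτ)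
    {c : ℝ} (hc : ∀ w : Finset Λ, w.card = nτ → ∀ I : Finset Λ, I.card = nσ →
      c ≤ ∑ i ∈ I, (isHermitian_lmOneBody G t U w).eigenvalues i) :
    c * normSq ψ ≤ (star ψ ⬝ᵥ (speciesHamiltonian G t U σ *ᵥ ψ)).re := by
  classical
  -- block decomposition along the frozen configurations of species `τ`
  rw [rayleigh_eq_sum_configProj τ (commute_speciesHamiltonian_configProj G t U hστ) ψ, Complex.re_sum,
    ← sum_normSq_configProj_mulVec τ ψ, Finset.mul_sum]
  refine Finset.sum_le_sum fun w _ => ?_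
  set φ := configProj τ w *ᵥ ψ with hφ
  -- on the block, `H_σ` acts as the free problem `dΓ_σ(A_w)`
  have hact : speciesHamiltonian G t U σ *ᵥ φ = dGammaSpin σ (lmOneBody G t U w) *ᵥ φ := by
    rw [hφ, mulVec_mulVec, mulVec_mulVec, speciesHamiltonian_mul_configProj G t U hστ w]
  rw [hact]
  have hφapp : ∀ s, φ s = if occ τ s = w then ψ s else 0 := fun s => configProj_mulVec_apply τ w ψ s
  by_cases hw : w.card = nτ
  · refine fermiSum_mul_normSq_le_re_rayleigh_dGammaSpin σ (isHermitian_lmOneBody G t U w) hnσ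
      (fun s hs => ?_) (hc w hw)
    rw [hφapp] at hs
    by_cases h : occ τ s = w
    · rw [if_pos h] at hs
      exact hσ s hs
    · rw [if_neg h] at hs
      exact absurd rfl hs
  · -- configurations of the wrong cardinality carry no weight
    have hz : φ = 0 := by
      funext s
      rw [hφapp, Pi.zero_apply]
      by_cases h : occ τ s = w
      · rw [if_pos h]
        by_contra hs
        exact hw (h ▸ hτ s hs)
      · rw [if_neg h]
    rw [hz, mulVec_zero, dotProduct_zero, Complex.zero_re]
    simp [normSq]

/-- **Langer–Mattis' `E₀ ≥ E₁ + E₂` on Lieb's sector `(a, b)`.** For `ψ` with `a` up- and `b`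
down-electrons: if `c₀ ≤ Σ_{i∈I} λ_i(A_w)` for all `|w| = b`, `|I| = a` (up-electrons mobile,
down-electrons frozen) and `c₁ ≤ Σ_{j∈J} λ_j(A_w)` for all `|w| = a`, `|J| = b` (the reverse), then
`(c₀ + c₁) ‖ψ‖² ≤ Re ⟨ψ, H ψ⟩` — for all real `t`, `U` and every finite graph.
[cite: LangerMattis1971, eqs. (4)–(5)] -/
theorem fermiSum_mul_normSq_le_re_rayleigh_hamiltonian_of_isInSector (t U : ℝ) {a b : ℕ}
    {ψ : Fock (Orb Λ)} (hψ : IsInSector a b ψ) {c₀ c₁ : ℝ}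
    (h₀ : ∀ w : Finset Λ, w.card = b → ∀ I : Finset Λ, I.card = a →
      c₀ ≤ ∑ i ∈ I, (isHermitian_lmOneBody G t U w).eigenvalues i)
    (h₁ : ∀ w : Finset Λ, w.card = a → ∀ J : Finset Λ, J.card = b →
      c₁ ≤ ∑ j ∈ J, (isHermitian_lmOneBody G t U w).eigenvalues j) :
    (c₀ + c₁) * normSq ψ ≤ (star ψ ⬝ᵥ (hamiltonian G t U *ᵥ ψ)).re := by
  by_cases hψ0 : ψ = 0
  · subst hψ0
    rw [mulVec_zero, dotProduct_zero, Complex.zero_re]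
    simp [normSq]
  obtain ⟨ha, hb⟩ := le_card_of_isInSector hψ hψ0
  have hocc : ∀ s, ψ s ≠ 0 → (occ 0 s).card = a ∧ (occ 1 s).card = b := fun s hs =>
    card_occ_of_isInSector hψ hs
  have e0 := fermiSum_mul_normSq_le_re_rayleigh_speciesHamiltonian G t U (σ := 0) (τ := 1)
    (by decide) ha (fun s hs => (hocc s hs).1) (fun s hs => (hocc s hs).2) h₀
  have e1 := fermiSum_mul_normSq_le_re_rayleigh_speciesHamiltonian G t U (σ := 1) (τ := 0)
    (by decide) hb (fun s hs => (hocc s hs).2) (fun s hs => (hocc s hs).1) h₁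
  rw [hamiltonian_eq_add_speciesHamiltonian, add_mulVec, dotProduct_add, Complex.add_re]
  linarith

/-! ### Assembly: the ground-state energy -/

/-- **A bound valid on every sector bounds the ground-state energy**: if
`c ‖φ‖² ≤ Re ⟨φ, H φ⟩` for every `φ` of every sector `(a, N - a)`, then `c ≤ groundEnergyAt G t U N`
(`N ≤ 2|Λ|`): `H` conserves `(N_↑, N_↓)`, so a ground state of the `N`-particle sector has a
nonzero component in some sector `(a, N - a)`, itself a ground state.
[cite: LiebPRL1989, proof of Theorem 1] -/
theorem groundEnergyAt_ge_of_forall_isInSector (t U : ℝ) {N : ℕ} (hN : N ≤ 2 * Fintype.card Λ)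
    {c : ℝ} (h : ∀ a b : ℕ, a + b = N → ∀ φ : Fock (Orb Λ), IsInSector a b φ →
      c * normSq φ ≤ (star φ ⬝ᵥ (hamiltonian G t U *ᵥ φ)).re) :
    c ≤ groundEnergyAt G t U N := by
  classical
  obtain ⟨ψ, hψN, hψ1, hHψ⟩ := ThermodynamicLimit.exists_unit_groundState G t U hN
  have hψ0 : ψ ≠ 0 := by
    intro h0
    rw [h0, star_zero, zero_dotProduct] at hψ1
    exact zero_ne_one hψ1
  -- a nonzero sector component of the ground state
  obtain ⟨a, ha, hva⟩ : ∃ a ∈ range (N + 1), sectorProj a (N - a) ψ ≠ 0 := by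
    by_contra hall
    push Not at hall
    exact hψ0 ((sum_sectorProj_eq hψN).symm.trans (Finset.sum_eq_zero hall))
  have haN : a + (N - a) = N := by
    rw [Finset.mem_range] at ha
    omega
  set φ := sectorProj a (N - a) ψ with hφ
  have hHφ : hamiltonian G t U *ᵥ φ = ((groundEnergyAt G t U N : ℝ) : ℂ) • φ := by
    rw [hφ, (LiebThm1.preservesSectors_hamiltonian G t U).mulVec_sectorProj, hHψ, sectorProj_smul]
  have hE : (star φ ⬝ᵥ (hamiltonian G t U *ᵥ φ)).re = groundEnergyAt G t U N * normSq φ := by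
    rw [hHφ, dotProduct_smul, star_dotProduct_self_eq_normSq, smul_eq_mul, ← Complex.ofReal_mul,
      Complex.ofReal_re]
  have hpos : 0 < normSq φ :=
    lt_of_le_of_ne (normSq_nonneg φ) fun h0 => hva (eq_zero_of_normSq_eq_zero h0.symm)
  have hb := h a (N - a) haN φ (isInSector_sectorProj _ _ _)
  rw [hE] at hb
  exact le_of_mul_le_mul_right hb hpos

/-- **The Fermi-sum certificate for the Hubbard ground-state energy** (Langer–Mattis' species split
sector by sector). On any finite graph `G`, for all real `t`, `U` and `N ≤ 2|Λ|`: suppose that for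
every splitting `a + b = N` with `a, b ≤ |Λ|` there are reals `c₀, c₁` with `c ≤ c₀ + c₁`,
`c₀ ≤ Σ_{i∈I} λ_i(A_w)` for all `|w| = b`, `|I| = a`, and `c₁ ≤ Σ_{j∈J} λ_j(A_w)` for all `|w| = a`,
`|J| = b`, where `λ_i(A_w)` are the eigenvalues of `A_w = -tA_G + (U/2) 1_w` (`lmOneBody`). Then
`c ≤ groundEnergyAt G t U N`. In words: `E_G(N) ≥ min_{a+b=N} [F(a;b) + F(b;a)]`,
`F(a;b) = min_{|w|=b}` (sum of the `a` lowest eigenvalues of `A_w`) — Langer–Mattis, Phys. Lett. 36A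
(1971) 139, eqs. (4)–(5) (`E₀ ≥ E₁ + E₂`, each species in the frozen field of the other), with the
frozen configuration minimised instead of fixed to a sublattice. [cite: LangerMattis1971, eqs. (4)–(5)] -/
theorem groundEnergyAt_ge_of_fermiSums (t U : ℝ) {N : ℕ} (hN : N ≤ 2 * Fintype.card Λ) {c : ℝ}
    (h : ∀ a b : ℕ, a + b = N → a ≤ Fintype.card Λ → b ≤ Fintype.card Λ →
      ∃ c₀ c₁ : ℝ, c ≤ c₀ + c₁ ∧
        (∀ w : Finset Λ, w.card = b → ∀ I : Finset Λ, I.card = a →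
            c₀ ≤ ∑ i ∈ I, (isHermitian_lmOneBody G t U w).eigenvalues i) ∧
        (∀ w : Finset Λ, w.card = a → ∀ J : Finset Λ, J.card = b →
            c₁ ≤ ∑ j ∈ J, (isHermitian_lmOneBody G t U w).eigenvalues j)) :
    c ≤ groundEnergyAt G t U N := by
  refine groundEnergyAt_ge_of_forall_isInSector G t U hN fun a b hab φ hφ => ?_
  by_cases hφ0 : φ = 0
  · subst hφ0
    rw [mulVec_zero, dotProduct_zero, Complex.zero_re]
    simp [normSq]
  obtain ⟨ha, hb⟩ := le_card_of_isInSector hφ hφ0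
  obtain ⟨c₀, c₁, hc, h₀, h₁⟩ := h a b hab ha hb
  exact le_trans (mul_le_mul_of_nonneg_right hc (normSq_nonneg φ))
    (fermiSum_mul_normSq_le_re_rayleigh_hamiltonian_of_isInSector G t U hφ h₀ h₁)

end LangerMattis

end Literature.MathematicalPhysics.QuantumLattice
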